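import Literature.Barriers.Parity.SiegelZeroDichotomyChowlaStep3Local
import HarnessLib

/-!
# Step (iii) of Tao–Teräväinen at `k = 0`: the fine bound `|β_s(p^k)| ≤ 1 + O(k² |s| log p)` and
# a subadditive exponent majorant for `|β_s(p^k)|`

Topic `Literature/Barriers/Parity`, sub-namespace `TaoTeravainen`; a file of the proof DAG of
`Literature.Barriers.Parity.TaoTeravainen2021_chowla`, towards `TaoTeravainen2021_lemma61`
(Lemma 6.1). Everything here is PROVED.

The source (proof of Lemma 6.1) bounds the prime-power values of the twisted coefficients
`β_t` ((6.11)): "`|β_t(p^j)| = 1` when `p ≤ R` and `χ(p) = -1` …, `|β_t(p^j)| = p^{j/log R}` when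
`p ≤ R` and `χ(p) = 0`. For `χ(p) = +1` … `β_t(p^j) = P_j(p^{(1+it)/log R})` where
`P_j(z) := 1 - 2z + 2z² - ⋯ + (-1)^j 2z^j`. Note that `|P_j(1)| ≤ 1` and
`P'_j(z) ≪ j^{O(1)}(1 + |z|^{j-1})` …, hence `|P_j(z)| ≤ 1 + O(|z-1| j^{O(1)})` … Also
`|P_j(z)| ≪ j|z|^j` for `|z| ≥ 1`. We thus have
`|P_j(z)| ≤ min(1 + j^{O(1)}|z-1|, exp(O(j log|z| + 1 + log j)))` … Thus regardless of the value of
`χ(p)`, we have the upper bound `|β_t(p^j)| ≤ exp(O(a_{t,p^j}))` for `p ≤ R`, where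
`a_{t,p^j} := min(j^C (1+|t|) log_R p, j log_R p + 1 + log j)` … Using the definition of
`a_{t,p^j}` and the inequality `(j₁+j₂)^C ≪_C j₁^C + j₂^C` …" [cite: TaoTeravainen2021, §6, proof of Lemma 6.1]

Here, for the sibling file's `betaAF χ N s` (`N = ⌊R⌋₊ + 1`) and an arbitrary exponent `s` with
`Re s ≥ 0` (in the application `s = (1 + 2πit)/log R`, so `|s| log p ≍ (1+|t|) log_R p` and
`(Re s) log p = log_R p`):

* `norm_cexp_sub_one_le` — `‖e^w - 1‖ ≤ 2‖w‖e^{‖w‖}`; `norm_natCast_pow_cpow_sub_one_le` —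
  `‖(p^i)^s - 1‖ ≤ 2 i δ e^{iδ}`, `δ = ‖s‖ log p`;
* **`norm_betaAF_prime_pow_le_fine`** — for `p ≤ R` prime: `‖β_s(p^k)‖ ≤ 1 + 4k² δ e^{kδ}`
  (uniformly in `χ(p) ∈ {0, ±1}`: `β_s(p^k) = Σ_i g(pⁱ)(pⁱ)^s χ(p)^{k-i}`, whose value with all
  `(pⁱ)^s` replaced by `1` is `λ_Siegel(p^k) = (-1)^k`);
* `bExp s p k := min(5k² ‖s‖ log p, log(2k+1) + k (Re s) log p)` (`k ≥ 1`; `0` at `k = 0`) — the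
  source's `O(a_{t,p^k})` in explicit form — with **`norm_betaAF_prime_pow_le_exp_bExp`**:
  `‖β_s(p^k)‖ ≤ exp(bExp s p k)` for `p ≤ R`, and **`bExp_add_le`**:
  `bExp s p (k₁ + k₂) ≤ 4 (bExp s p k₁ + bExp s p k₂)` (`k₁, k₂ ≥ 1`, `p ≤ R`, `R > 1`) — the
  subadditivity "`a_{t,p^{j₁+j₂}} ≪ a_{t,p^{j₁}} + a_{t,p^{j₂}}`" that makes Landreau's splitting work.
  [cite: TaoTeravainen2021, §6, proof of Lemma 6.1]
-/

noncomputable section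

open Finset ArithmeticFunction Complex Real

namespace Literature.Barriers.Parity.TaoTeravainen

variable {q : ℕ} (χ : DirichletCharacter ℂ q)

/-! ### `‖e^w - 1‖ ≤ 2‖w‖ e^{‖w‖}` and `‖(pⁱ)^s - 1‖ ≤ 2iδe^{iδ}` -/

/-- `‖e^w - 1‖ ≤ 2‖w‖ e^{‖w‖}` for every complex `w` (for `‖w‖ ≤ 1` this is Mathlib's
`‖e^w - 1‖ ≤ 2‖w‖`; for `‖w‖ > 1`, `‖e^w - 1‖ ≤ e^{‖w‖} + 1 ≤ 2‖w‖e^{‖w‖}`). [folklore] -/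
theorem norm_cexp_sub_one_le (w : ℂ) : ‖Complex.exp w - 1‖ ≤ 2 * ‖w‖ * Real.exp ‖w‖ := by
  have h0 : 0 ≤ ‖w‖ := norm_nonneg w
  have he : 1 ≤ Real.exp ‖w‖ := Real.one_le_exp h0
  rcases le_or_gt ‖w‖ 1 with hw | hw
  · calc ‖Complex.exp w - 1‖ ≤ 2 * ‖w‖ := Complex.norm_exp_sub_one_le hw
      _ ≤ 2 * ‖w‖ * Real.exp ‖w‖ := le_mul_of_one_le_right (by positivity) he
  · calc ‖Complex.exp w - 1‖ ≤ ‖Complex.exp w‖ + ‖(1 : ℂ)‖ := norm_sub_le _ _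
      _ ≤ Real.exp ‖w‖ + 1 := by
          rw [norm_one, Complex.norm_exp]
          exact add_le_add (Real.exp_le_exp.mpr (Complex.re_le_norm w)) le_rfl
      _ ≤ 2 * Real.exp ‖w‖ := by linarith
      _ ≤ 2 * ‖w‖ * Real.exp ‖w‖ := by nlinarith [Real.exp_pos ‖w‖]

/-- **`‖(pⁱ)^s - 1‖ ≤ 2 i δ e^{iδ}`**, `δ = ‖s‖ log p`, for `p ≥ 1` (`(pⁱ)^s = e^{i s log p}`).
[cite: TaoTeravainen2021, §6, proof of Lemma 6.1 ("`|P_j(z)| ≤ 1 + O(|z-1| j^{O(1)})`")] -/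
theorem norm_natCast_pow_cpow_sub_one_le {p : ℕ} (hp : 0 < p) (i : ℕ) (s : ℂ) :
    ‖((p ^ i : ℕ) : ℂ) ^ s - 1‖ ≤
      2 * (i * (‖s‖ * Real.log p)) * Real.exp (i * (‖s‖ * Real.log p)) := by
  have hp0 : ((p ^ i : ℕ) : ℂ) ≠ 0 := by exact_mod_cast (pow_pos hp i).ne'
  have hlog : Complex.log ((p ^ i : ℕ) : ℂ) = ((i * Real.log p : ℝ) : ℂ) := by
    rw [← Complex.natCast_log, Nat.cast_pow, Real.log_pow]
  rw [Complex.cpow_def_of_ne_zero hp0, hlog]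
  have hnorm : ‖((i * Real.log p : ℝ) : ℂ) * s‖ = i * (‖s‖ * Real.log p) := by
    rw [norm_mul, Complex.norm_real, Real.norm_eq_abs,
      abs_of_nonneg (mul_nonneg (Nat.cast_nonneg i) (Real.log_natCast_nonneg p))]
    ring
  have h := norm_cexp_sub_one_le (((i * Real.log p : ℝ) : ℂ) * s)
  rwa [hnorm] at h

/-! ### The value at `s = 0`: `Σ_i g(pⁱ) χ(p)^{k-i} = λ_Siegel(p^k) = (-1)^k` for `p ≤ R` -/

/-- For `p ≤ R` prime and quadratic `χ`, `Σ_{i ≤ k} g(pⁱ) χ(p)^{k-i} = (-1)^k` (`g ∗ χ = λ_Siegel`).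
[cite: TaoTeravainen2021, §6 (first display) with §4 (4.1)] -/
theorem sum_siegelCoeffAF_mul_pow_eq (hχ : χ.IsQuadratic) {R : ℝ} {p : ℕ} (hp : p.Prime)
    (hpR : (p : ℝ) ≤ R) (k : ℕ) :
    ∑ i ∈ range (k + 1), siegelCoeffAF χ (⌊R⌋₊ + 1) (p ^ i) * realChar χ p ^ (k - i) = (-1) ^ k := by
  rw [← siegelCoeffAF_mul_chiAF_prime_pow χ hχ _ hp k, ← liouvilleSiegelAF_eq χ hχ R,
    liouvilleSiegelAF_apply χ R (pow_ne_zero _ hp.ne_zero), liouvilleSiegel_prime_pow χ R hp k,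
    if_pos hpR]

/-! ### The fine bound -/

/-- **`‖β_s(p^k)‖ ≤ 1 + 4k² δ e^{kδ}`**, `δ = ‖s‖ log p`, for `p ≤ R` prime and quadratic `χ`
(write `(pⁱ)^s = 1 + ((pⁱ)^s - 1)`; the main part is `λ_Siegel(p^k) = ±1`, the rest is at most
`Σ_{i ≤ k} |g(pⁱ)| ‖(pⁱ)^s - 1‖ ≤ Σ_{i≤k} 2 · 2iδe^{iδ} ≤ 4k²δe^{kδ}`). This is the source's
`|P_j(z)| ≤ 1 + O(|z-1| j^{O(1)})`, uniformly in `χ(p)`. [cite: TaoTeravainen2021, §6, proof of Lemma 6.1] -/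
theorem norm_betaAF_prime_pow_le_fine (hχ : χ.IsQuadratic) {R : ℝ} {p : ℕ} (hp : p.Prime)
    (hpR : (p : ℝ) ≤ R) (s : ℂ) (k : ℕ) :
    ‖betaAF χ (⌊R⌋₊ + 1) s (p ^ k)‖ ≤
      1 + 4 * (k : ℝ) ^ 2 * (‖s‖ * Real.log p) * Real.exp (k * (‖s‖ * Real.log p)) := by
  set N := ⌊R⌋₊ + 1 with hN
  set δ : ℝ := ‖s‖ * Real.log p with hδ
  have hδ0 : 0 ≤ δ := mul_nonneg (norm_nonneg _) (Real.log_natCast_nonneg p)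
  set c : ℂ := (realChar χ p : ℂ) with hc
  have hcn : ‖c‖ ≤ 1 := norm_realChar_le_one χ p
  -- split `(pⁱ)^s = 1 + ((pⁱ)^s - 1)`
  set main : ℂ := ∑ i ∈ range (k + 1), (siegelCoeffAF χ N (p ^ i) : ℂ) * c ^ (k - i) with hmain
  set err : ℂ := ∑ i ∈ range (k + 1),
    (siegelCoeffAF χ N (p ^ i) : ℂ) * (((p ^ i : ℕ) : ℂ) ^ s - 1) * c ^ (k - i) with herr
  have hsplit : betaAF χ N s (p ^ k) = main + err := by
    rw [betaAF_prime_pow χ hχ N s hp k, hmain, herr, ← Finset.sum_add_distrib]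
    refine Finset.sum_congr rfl fun i _ => ?_
    ring
  -- the main part is `(-1)^k`
  have hmain1 : main = (-1) ^ k := by
    have h := sum_siegelCoeffAF_mul_pow_eq χ hχ hp hpR k
    have h' : ((∑ i ∈ range (k + 1), siegelCoeffAF χ N (p ^ i) * realChar χ p ^ (k - i) : ℝ) : ℂ) =
        (((-1 : ℝ) ^ k : ℝ) : ℂ) := by rw [h]
    push_cast at h'
    rw [hmain, hc]
    exact h'
  -- the error part
  have herr1 : ‖err‖ ≤ 4 * (k : ℝ) ^ 2 * δ * Real.exp (k * δ) := by
    have hterm : ∀ i ∈ range (k + 1), ‖(siegelCoeffAF χ N (p ^ i) : ℂ) *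
        (((p ^ i : ℕ) : ℂ) ^ s - 1) * c ^ (k - i)‖ ≤ 4 * (k * δ * Real.exp (k * δ)) := by
      intro i hi
      have hik : i ≤ k := Nat.lt_succ_iff.mp (mem_range.mp hi)
      rcases Nat.eq_zero_or_pos i with rfl | hi0
      · simp
        positivity
      · rw [norm_mul, norm_mul, norm_pow]
        have h1 : ‖(siegelCoeffAF χ N (p ^ i) : ℂ)‖ ≤ 2 :=
          norm_siegelCoeffAF_prime_pow_le χ N hp hi0.ne'
        have h2 := norm_natCast_pow_cpow_sub_one_le hp.pos i s
        have h3 : ‖c‖ ^ (k - i) ≤ 1 := pow_le_one₀ (norm_nonneg _) hcn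
        have h4 : (i : ℝ) * δ * Real.exp (i * δ) ≤ k * δ * Real.exp (k * δ) := by
          have hik' : (i : ℝ) ≤ k := by exact_mod_cast hik
          gcongr
        calc ‖(siegelCoeffAF χ N (p ^ i) : ℂ)‖ * ‖((p ^ i : ℕ) : ℂ) ^ s - 1‖ * ‖c‖ ^ (k - i)
            ≤ 2 * (2 * (i * δ) * Real.exp (i * δ)) * 1 := by
              refine mul_le_mul (mul_le_mul h1 h2 (norm_nonneg _) (by norm_num)) h3
                (by positivity) (by positivity)
          _ = 4 * (i * δ * Real.exp (i * δ)) := by ring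
          _ ≤ 4 * (k * δ * Real.exp (k * δ)) := by gcongr
    calc ‖err‖ ≤ ∑ i ∈ range (k + 1), ‖(siegelCoeffAF χ N (p ^ i) : ℂ) *
          (((p ^ i : ℕ) : ℂ) ^ s - 1) * c ^ (k - i)‖ := norm_sum_le _ _
      _ = ∑ i ∈ range k, ‖(siegelCoeffAF χ N (p ^ (i + 1)) : ℂ) *
          (((p ^ (i + 1) : ℕ) : ℂ) ^ s - 1) * c ^ (k - (i + 1))‖ := by
          rw [Finset.sum_range_succ']
          simp [(isMultiplicative_siegelCoeffAF χ hχ N).map_one]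
      _ ≤ ∑ _i ∈ range k, 4 * (k * δ * Real.exp (k * δ)) :=
          Finset.sum_le_sum fun i hi => hterm (i + 1) (by
            rw [mem_range] at hi ⊢; omega)
      _ = 4 * (k : ℝ) ^ 2 * δ * Real.exp (k * δ) := by
          rw [Finset.sum_const, Finset.card_range, nsmul_eq_mul]; ring
  calc ‖betaAF χ N s (p ^ k)‖ = ‖main + err‖ := by rw [hsplit]
    _ ≤ ‖main‖ + ‖err‖ := norm_add_le _ _
    _ ≤ 1 + 4 * (k : ℝ) ^ 2 * δ * Real.exp (k * δ) := by
        refine add_le_add ?_ herr1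
        rw [hmain1, norm_pow, norm_neg, norm_one, one_pow]

/-! ### The exponent majorant `bExp` and its subadditivity -/

/-- The exponent majorant (the source's `O(a_{t,p^k})` made explicit):
`bExp s p k = min(5k² ‖s‖ log p, log(2k+1) + k (Re s) log p)` for `k ≥ 1`, and `0` for `k = 0`.
[cite: TaoTeravainen2021, §6, proof of Lemma 6.1 (definition of `a_{t,p^j}`)] -/
def bExp (s : ℂ) (p k : ℕ) : ℝ :=
  if k = 0 then 0
  else min (5 * (k : ℝ) ^ 2 * (‖s‖ * Real.log p)) (Real.log (2 * k + 1) + k * (s.re * Real.log p))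

/-- `bExp s p 0 = 0`. [folklore] -/
@[simp] theorem bExp_zero (s : ℂ) (p : ℕ) : bExp s p 0 = 0 := if_pos rfl

/-- `0 ≤ bExp` when `Re s ≥ 0`. [folklore] -/
theorem bExp_nonneg {s : ℂ} (hs : 0 ≤ s.re) (p k : ℕ) : 0 ≤ bExp s p k := by
  unfold bExp
  split_ifs
  · exact le_rfl
  · refine le_min (by positivity) (add_nonneg (Real.log_nonneg (by linarith)) ?_)
    exact mul_nonneg (Nat.cast_nonneg _) (mul_nonneg hs (Real.log_natCast_nonneg p))

/-- `bExp ≤ 5k²‖s‖ log p` (the fine branch). [folklore] -/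
theorem bExp_le_fine (s : ℂ) (p : ℕ) {k : ℕ} (hk : k ≠ 0) :
    bExp s p k ≤ 5 * (k : ℝ) ^ 2 * (‖s‖ * Real.log p) := by
  unfold bExp; rw [if_neg hk]; exact min_le_left _ _

/-- `bExp ≤ log(2k+1) + k (Re s) log p` (the crude branch). [folklore] -/
theorem bExp_le_crude (s : ℂ) (p : ℕ) {k : ℕ} (hk : k ≠ 0) :
    bExp s p k ≤ Real.log (2 * k + 1) + k * (s.re * Real.log p) := by
  unfold bExp; rw [if_neg hk]; exact min_le_right _ _

/-- **`‖β_s(p^k)‖ ≤ exp(bExp s p k)`** for `p ≤ R` prime, `Re s ≥ 0`, quadratic `χ` (the fine bound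
`1 + 4k²δe^{kδ} ≤ e^{5k²δ}` and the crude bound `(2k+1)p^{k Re s}` of the sibling file).
[cite: TaoTeravainen2021, §6, proof of Lemma 6.1 ("`|β_t(p^j)| ≤ exp(O(a_{t,p^j}))`")] -/
theorem norm_betaAF_prime_pow_le_exp_bExp (hχ : χ.IsQuadratic) {R : ℝ} {p : ℕ} (hp : p.Prime)
    (hpR : (p : ℝ) ≤ R) {s : ℂ} (hs : 0 ≤ s.re) (k : ℕ) :
    ‖betaAF χ (⌊R⌋₊ + 1) s (p ^ k)‖ ≤ Real.exp (bExp s p k) := by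
  rcases Nat.eq_zero_or_pos k with rfl | hk
  · rw [pow_zero, (isMultiplicative_betaAF χ hχ _ s).map_one, norm_one, bExp_zero, Real.exp_zero]
  unfold bExp
  rw [if_neg hk.ne']
  rcases min_cases (5 * (k : ℝ) ^ 2 * (‖s‖ * Real.log p))
    (Real.log (2 * k + 1) + k * (s.re * Real.log p)) with ⟨hmin, _⟩ | ⟨hmin, _⟩ <;> rw [hmin]
  · -- fine branch: `1 + 4k²δe^{kδ} ≤ e^{4k²δ + kδ} ≤ e^{5k²δ}`
    set δ := ‖s‖ * Real.log p with hδ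
    have hδ0 : 0 ≤ δ := mul_nonneg (norm_nonneg _) (Real.log_natCast_nonneg p)
    have h1 := norm_betaAF_prime_pow_le_fine χ hχ hp hpR s k
    have hk1 : (1 : ℝ) ≤ k := by exact_mod_cast hk
    calc ‖betaAF χ (⌊R⌋₊ + 1) s (p ^ k)‖ ≤ 1 + 4 * (k : ℝ) ^ 2 * δ * Real.exp (k * δ) := h1
      _ ≤ Real.exp (4 * (k : ℝ) ^ 2 * δ) * Real.exp (k * δ) := by
          have h2 : 1 + 4 * (k : ℝ) ^ 2 * δ ≤ Real.exp (4 * (k : ℝ) ^ 2 * δ) := by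
            linarith [Real.add_one_le_exp (4 * (k : ℝ) ^ 2 * δ)]
          have h3 : 1 ≤ Real.exp (k * δ) := Real.one_le_exp (by positivity)
          have h4 : 0 ≤ 4 * (k : ℝ) ^ 2 * δ := by positivity
          have h5 : 0 < Real.exp (k * δ) := Real.exp_pos _
          calc 1 + 4 * (k : ℝ) ^ 2 * δ * Real.exp (k * δ)
              ≤ Real.exp (k * δ) + 4 * (k : ℝ) ^ 2 * δ * Real.exp (k * δ) := by linarith
            _ = (1 + 4 * (k : ℝ) ^ 2 * δ) * Real.exp (k * δ) := by ring
            _ ≤ Real.exp (4 * (k : ℝ) ^ 2 * δ) * Real.exp (k * δ) :=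
                mul_le_mul_of_nonneg_right h2 h5.le
      _ = Real.exp (4 * (k : ℝ) ^ 2 * δ + k * δ) := (Real.exp_add _ _).symm
      _ ≤ Real.exp (5 * (k : ℝ) ^ 2 * δ) := by
          refine Real.exp_le_exp.mpr ?_
          have : (k : ℝ) * δ ≤ (k : ℝ) ^ 2 * δ := mul_le_mul_of_nonneg_right (by nlinarith) hδ0
          linarith
  · -- crude branch
    have h1 := norm_betaAF_prime_pow_le χ hχ (⌊R⌋₊ + 1) hs hp k
    have hp1 : (0 : ℝ) < p := by exact_mod_cast hp.pos
    rw [Real.exp_add, Real.exp_log (by positivity), show (k : ℝ) * (s.re * Real.log p) =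
      Real.log p * (k * s.re) by ring, Real.exp_mul, Real.exp_log hp1]
    exact h1

set_option maxHeartbeats 400000 in
/-- **Subadditivity of the exponent**: for `Re s ≥ 0`, `(Re s) log p ≤ 1` (e.g. `p ≤ R`,
`Re s = 1/log R`) and `k₁, k₂ ≥ 1`,
`bExp s p (k₁ + k₂) ≤ 4 (bExp s p k₁ + bExp s p k₂)` (the three cases fine/fine, crude/crude,
fine/crude of "`a_{t,p^{j₁+j₂}} ≪ a_{t,p^{j₁}} + a_{t,p^{j₂}}`").
[cite: TaoTeravainen2021, §6, proof of Lemma 6.1] -/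
theorem bExp_add_le {s : ℂ} (hs : 0 ≤ s.re) {p : ℕ} (hsp : s.re * Real.log p ≤ 1)
    {k₁ k₂ : ℕ} (hk₁ : 1 ≤ k₁) (hk₂ : 1 ≤ k₂) :
    bExp s p (k₁ + k₂) ≤ 4 * (bExp s p k₁ + bExp s p k₂) := by
  set δ : ℝ := ‖s‖ * Real.log p with hδ
  set ℓ : ℝ := s.re * Real.log p with hℓ
  have hlogp : 0 ≤ Real.log p := Real.log_natCast_nonneg p
  have hδ0 : 0 ≤ δ := mul_nonneg (norm_nonneg _) hlogp
  have hℓ0 : 0 ≤ ℓ := mul_nonneg hs hlogp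
  have hℓδ : ℓ ≤ δ := mul_le_mul_of_nonneg_right (Complex.re_le_norm s) hlogp
  -- the two branches
  set A : ℕ → ℝ := fun k => 5 * (k : ℝ) ^ 2 * δ with hA
  set B : ℕ → ℝ := fun k => Real.log (2 * k + 1) + k * ℓ with hB
  have hbE : ∀ {k : ℕ}, 1 ≤ k → bExp s p k = min (A k) (B k) := fun {k} hk => by
    unfold bExp; rw [if_neg (by omega)]
  have hx₁ : (1 : ℝ) ≤ k₁ := by exact_mod_cast hk₁
  have hx₂ : (1 : ℝ) ≤ k₂ := by exact_mod_cast hk₂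
  have hlog3 : (1 : ℝ) < Real.log 3 := by
    rw [Real.lt_log_iff_exp_lt (by norm_num)]
    have h := Real.exp_one_lt_d9
    linarith
  have hBge : ∀ {k : ℕ}, 1 ≤ k → 1 ≤ B k := fun {k} hk => by
    have hk' : (1 : ℝ) ≤ k := by exact_mod_cast hk
    have : Real.log 3 ≤ Real.log (2 * k + 1) := Real.log_le_log (by norm_num) (by linarith)
    simp only [hB]
    nlinarith
  have hBlog : ∀ k : ℕ, Real.log (2 * k + 1) ≤ B k := fun k => by
    simp only [hB]; nlinarith [(Nat.cast_nonneg k : (0 : ℝ) ≤ k)]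
  -- `B` is subadditive, `A(k₁+k₂) ≤ 2(A k₁ + A k₂)`
  have hBsub : B (k₁ + k₂) ≤ B k₁ + B k₂ := by
    simp only [hB]
    push_cast
    have : Real.log (2 * (k₁ + k₂ : ℝ) + 1) ≤ Real.log (2 * k₁ + 1) + Real.log (2 * k₂ + 1) := by
      rw [← Real.log_mul (by positivity) (by positivity)]
      exact Real.log_le_log (by positivity) (by nlinarith)
    nlinarith
  have hAsub : A (k₁ + k₂) ≤ 2 * (A k₁ + A k₂) := by
    simp only [hA]; push_cast; nlinarith [sq_nonneg ((k₁ : ℝ) - k₂)]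
  have hgoal : bExp s p (k₁ + k₂) = min (A (k₁ + k₂)) (B (k₁ + k₂)) := hbE (by omega)
  rw [hgoal, hbE hk₁, hbE hk₂]
  -- the mixed case, in the form `B(k₁+k₂) ≤ A k₁ + 4 B k₂` when `A k₁ ≤ B k₁` and `B k₂ ≤ A k₂`
  have hmixed : ∀ {a b : ℕ}, 1 ≤ a → 1 ≤ b → A a ≤ B a → B b ≤ A b →
      B (a + b) ≤ A a + 4 * B b := by
    intro a b ha hb hAB hBA
    have ha' : (1 : ℝ) ≤ a := by exact_mod_cast ha
    have hb' : (1 : ℝ) ≤ b := by exact_mod_cast hb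
    have ha0 : (0 : ℝ) < a := by linarith
    -- (a) `5δa ≤ 3`
    have hBa : B a ≤ 3 * a := by
      simp only [hB]
      have h1 : Real.log (2 * a + 1) ≤ 2 * a := by
        have := Real.log_le_sub_one_of_pos (show (0 : ℝ) < 2 * a + 1 by positivity); linarith
      have h2 : (a : ℝ) * ℓ ≤ a * 1 := mul_le_mul_of_nonneg_left hsp ha0.le
      linarith
    have h5a : 5 * δ * a ≤ 3 := by
      have h : A a ≤ 3 * a := hAB.trans hBa
      simp only [hA] at h
      have h' : (5 * δ * a) * a ≤ 3 * a := by nlinarith [h]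
      exact le_of_mul_le_mul_right h' ha0
    -- (b) `1 ≤ 5δb²`
    have h5b : 1 ≤ 5 * δ * (b : ℝ) ^ 2 := by
      have h := (hBge hb).trans hBA
      simp only [hA] at h; linarith
    have hδpos : 0 < δ := by
      by_contra hneg
      push Not at hneg
      have : 5 * δ * (b : ℝ) ^ 2 ≤ 0 :=
        mul_nonpos_of_nonpos_of_nonneg (by linarith) (sq_nonneg _)
      linarith
    -- hence `a ≤ 3b²`
    have hab : (a : ℝ) ≤ 3 * (b : ℝ) ^ 2 := by
      have h : 5 * δ * a ≤ 5 * δ * (3 * (b : ℝ) ^ 2) := by linarith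
      exact le_of_mul_le_mul_left h (by positivity)
    -- `log(2(a+b)+1) ≤ 3 log(2b+1)`
    have hlogab : Real.log (2 * ((a : ℝ) + b) + 1) ≤ 3 * Real.log (2 * b + 1) := by
      have hb2 : (0 : ℝ) ≤ b * b ^ 2 := by positivity
      have h1 : 2 * ((a : ℝ) + b) + 1 ≤ (2 * b + 1) ^ 3 := by nlinarith
      calc Real.log (2 * ((a : ℝ) + b) + 1) ≤ Real.log ((2 * b + 1) ^ 3) :=
            Real.log_le_log (by positivity) h1
        _ = 3 * Real.log (2 * b + 1) := by rw [Real.log_pow]; norm_num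
    have hal : (a : ℝ) * ℓ ≤ A a := by
      simp only [hA]
      calc (a : ℝ) * ℓ ≤ a * δ := mul_le_mul_of_nonneg_left hℓδ ha0.le
        _ ≤ 5 * (a : ℝ) ^ 2 * δ := by
            nlinarith [mul_nonneg (mul_nonneg ha0.le hδpos.le) (show (0 : ℝ) ≤ 5 * a - 1 by linarith)]
    have hbl0 : 0 ≤ (b : ℝ) * ℓ := by positivity
    have hlog0 : 0 ≤ Real.log (2 * (b : ℝ) + 1) := Real.log_nonneg (by linarith)
    simp only [hB]
    simp only [hA] at hal
    push_cast
    linarith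

  -- case analysis
  rcases le_total (A k₁) (B k₁) with h1 | h1 <;> rcases le_total (A k₂) (B k₂) with h2 | h2
  · -- fine / fine
    rw [min_eq_left h1, min_eq_left h2]
    calc min (A (k₁ + k₂)) (B (k₁ + k₂)) ≤ A (k₁ + k₂) := min_le_left _ _
      _ ≤ 4 * (A k₁ + A k₂) := by
          have : 0 ≤ A k₁ + A k₂ := by simp only [hA]; positivity
          linarith
  · -- fine / crude
    rw [min_eq_left h1, min_eq_right h2]
    calc min (A (k₁ + k₂)) (B (k₁ + k₂)) ≤ B (k₁ + k₂) := min_le_right _ _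
      _ ≤ A k₁ + 4 * B k₂ := hmixed hk₁ hk₂ h1 h2
      _ ≤ 4 * (A k₁ + B k₂) := by
          have : 0 ≤ A k₁ := by simp only [hA]; positivity
          linarith
  · -- crude / fine
    rw [min_eq_right h1, min_eq_left h2]
    calc min (A (k₁ + k₂)) (B (k₁ + k₂)) ≤ B (k₁ + k₂) := min_le_right _ _
      _ = B (k₂ + k₁) := by rw [add_comm]
      _ ≤ A k₂ + 4 * B k₁ := hmixed hk₂ hk₁ h2 h1
      _ ≤ 4 * (B k₁ + A k₂) := by
          have : 0 ≤ A k₂ := by simp only [hA]; positivity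
          linarith
  · -- crude / crude
    rw [min_eq_right h1, min_eq_right h2]
    calc min (A (k₁ + k₂)) (B (k₁ + k₂)) ≤ B (k₁ + k₂) := min_le_right _ _
      _ ≤ B k₁ + B k₂ := hBsub
      _ ≤ 4 * (B k₁ + B k₂) := by
          have := hBge hk₁; have := hBge hk₂; linarith

end Literature.Barriers.Parity.TaoTeravainen
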